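import Summits.BirchSwinnertonDyer.BirchSwinnertonDyer.Theorems.GoldfeldAllTwistsTwoConverseTwinBirchLocalEight
import Summits.BirchSwinnertonDyer.BirchSwinnertonDyer.Theorems.GoldfeldAllTwistsTwoConverseTwinBirchLocalTen
import Literature.NumberTheory.EllipticCurves.GlobalMinimalModel
import HarnessLib

set_option linter.dupNamespace false -- `…BirchSwinnertonDyer.BirchSwinnertonDyer…` is the cell's namespace (D-0017)
set_option autoImplicit false

/-!
# LINE B49 — THEOREM B′ (family F2, `d_K = −8q`), local input (B1d′): the assembly **`Tam(W) = c₂·c₇·c_q = 16`** and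
# **`|u| = 1`** for every globally minimal model `W` of `49a1^{(−2q)}`, generic in the prime `q ≡ 1 (mod 4)`

Cell `bsd-goldfeld`, seat `bsd-goldfeld-s1p-c301` (prover, gen 9); planner ruling g25 (cii), scope memo
`HOME/GENUS-THEOREM-B-PRIME.md` factors F8 (`|u| = 1`) and F9 (`c_W = 16`). Support for item `stmt-BirchSwinnertonDyer-19140`
(twin″); Theses-free; theorems only. HONEST FRAMING: local arithmetic of an explicit family of Weierstrass models; nothing about
`L`-values or BSD. The F1 twins are `…TwinBirchTamagawa` §3 and `…TwinBirchFixedCurve` §3.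

Setting: `q` prime, `q ≡ 1 (mod 4)`, `(q/7) = −1`; `V′_q = X₀(49)^{(−8q)} = [0, 6q, 0, −128q², 512q³]` (file B1a′:
`twistModelEight_baseChange`, global minimality `isGloballyMinimal_twistModelEight`). WHAT IS PROVED:
* §1 **`Tam(V′_q) = 16`** (`tamagawaProduct_eq_prod` over the places `2, 7, q` of `ℤ`, `Δ = −2¹⁸7³q⁶`; `c₂ = 4` file B1b′,
  `c₇ = c_q = 2` file B1a′) and **`tamagawaProduct_eq_sixteen_of_smul_eq_negEight`**: `Tam(W) = 16` for EVERY model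
  `W = Cd • X₀(49)^{(d_K)}`, `K` imaginary quadratic with `d_K = −8q` — the constant `c_W` of `𝔮₄₉` on F2 (kit j273920: `16`
  on all 20 rows).
* §2 **`|Cd.u| = 1`** for every GLOBALLY MINIMAL `W` with `Cd • X₀(49)^{(−8q)} = W` (`X₀(49)^{(−8q)}` is itself globally
  minimal, file B1a′; two global minimal models differ by `u = ±1`, tree `isGloballyMinimal_unique_holds`) — factor `|u|`.
References: [Silverman1994] IV.9.4 and Table 4.1; [SilvermanAEC2009] VII.1.3(b), VII.6, VIII.8.3; [Kraus1989] Prop. 2.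
-/

noncomputable section

open scoped Classical NumberField

open WeierstrassCurve IsDedekindDomain IsLocalRing Rat.HeightOneSpectrum
  Literature.NumberTheory.EllipticCurves Literature.NumberTheory.EllipticCurves.ModularForms
  Summit.BirchSwinnertonDyer.BirchSwinnertonDyer.Rank2Observatory.Tate
  Summit.BirchSwinnertonDyer.BirchSwinnertonDyer.Rank2Observatory.RootNumber

namespace Summit.BirchSwinnertonDyer.BirchSwinnertonDyer.Theorems.GoldfeldGoodTwists

/-! ## §1 `Tam(V′_q) = 16` and `Tam(W) = 16` for every model `W` of `49a1^{(−2q)}` -/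

section AssemblyEight

variable {q : ℕ}

/-- **`Tam(V′_q) = c₂ · c₇ · c_q = 4 · 2 · 2 = 16`** for `V′_q = X₀(49)^{(−8q)}`, `q ≡ 1 (mod 4)` prime with `(q/7) = −1`
(bad places `⊆ {2, 7, q}` since `Δ = −2¹⁸7³q⁶`; product formula `tamagawaProduct_eq_prod`).
[cite: Silverman1994, IV.9.4 and Table 4.1] [cite: SilvermanAEC2009, VII.6] -/
theorem tamagawaProduct_twistEight (hq : q.Prime) (hq4 : q % 4 = 1) (hq7 : jacobiSym q 7 = -1) :
    (haveI := cm7.isElliptic_quadraticTwist (show (((-(8 * q) : ℤ)) : ℚ) ≠ 0 by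
       have := hq.pos; exact_mod_cast (show (-(8 * (q : ℤ))) ≠ 0 by omega))
     (cm7.quadraticTwist (((-(8 * q) : ℤ)) : ℚ)).tamagawaProduct) = 16 := by
  obtain ⟨hq2, hq7'⟩ := ne_two_and_ne_seven_of_jacobiSym hq7
  have hd : (((-(8 * q) : ℤ)) : ℚ) ≠ 0 := by
    have := hq.pos; exact_mod_cast (show (-(8 * (q : ℤ))) ≠ 0 by omega)
  haveI := cm7.isElliptic_quadraticTwist hd
  haveI : Fact (Nat.Prime 2) := ⟨Nat.prime_two⟩
  haveI : Fact (Nat.Prime 7) := ⟨by norm_num⟩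
  haveI : Fact q.Prime := ⟨hq⟩
  set v₂ : HeightOneSpectrum ℤ := (primesEquiv (R := ℤ)).symm ⟨2, Nat.prime_two⟩ with hv₂
  set v₇ : HeightOneSpectrum ℤ := (primesEquiv (R := ℤ)).symm ⟨7, by norm_num⟩ with hv₇
  set vq : HeightOneSpectrum ℤ := (primesEquiv (R := ℤ)).symm ⟨q, hq⟩ with hvq
  have h2 : (primesEquiv v₂ : ℕ) = 2 := by rw [hv₂, Equiv.apply_symm_apply]
  have h7 : (primesEquiv v₇ : ℕ) = 7 := by rw [hv₇, Equiv.apply_symm_apply]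
  have hqq : (primesEquiv vq : ℕ) = q := by rw [hvq, Equiv.apply_symm_apply]
  have hne27 : v₂ ≠ v₇ := by
    intro h; have := congrArg (fun v => (primesEquiv v : ℕ)) h; simp only [h2, h7] at this; omega
  have hne2q : v₂ ≠ vq := by
    intro h; have := congrArg (fun v => (primesEquiv v : ℕ)) h; simp only [h2, hqq] at this; omega
  have hne7q : v₇ ≠ vq := by
    intro h; have := congrArg (fun v => (primesEquiv v : ℕ)) h; simp only [h7, hqq] at this; omega
  have hprod := tamagawaProduct_eq_prod (cm7.quadraticTwist (((-(8 * q) : ℤ)) : ℚ)) {v₂, v₇, vq} (by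
    intro v hv
    by_contra hmem
    apply hv
    rw [← twistModelEight_baseChange]
    refine hasGoodReductionAt_of_not_dvd fun hdvd => hmem ?_
    rcases eq_of_prime_dvd_twistModelEight_Δ hq (prime_natGenerator v) hdvd with h | h | h
    · have : v = v₂ := by
        apply (primesEquiv (R := ℤ)).injective
        exact Subtype.ext (by rw [h2]; exact h)
      simp [this]
    · have : v = v₇ := by
        apply (primesEquiv (R := ℤ)).injective
        exact Subtype.ext (by rw [h7]; exact h)
      simp [this]
    · have : v = vq := by
        apply (primesEquiv (R := ℤ)).injective
        exact Subtype.ext (by rw [hqq]; exact h)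
      simp [this])
  rw [Finset.prod_insert (by simp [hne27, hne2q]), Finset.prod_pair hne7q] at hprod
  have c2 := localTamagawaNumber_padic_eq_of_forall_place (cm7.quadraticTwist (((-(8 * q) : ℤ)) : ℚ)) v₂ 2 h2 4
    (fun w hw => by
      rw [← localTamagawaNumber_padic_eq_holds _ w 2 hw]
      exact localTamagawaNumber_padic_twistEight_two hq hq4)
  have c7 := localTamagawaNumber_padic_eq_of_forall_place (cm7.quadraticTwist (((-(8 * q) : ℤ)) : ℚ)) v₇ 7 h7 2
    (fun w hw => by
      rw [← localTamagawaNumber_padic_eq_holds _ w 7 hw]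
      exact localTamagawaNumber_padic_twistEight_seven hq hq7)
  have cq := localTamagawaNumber_padic_eq_of_forall_place (cm7.quadraticTwist (((-(8 * q) : ℤ)) : ℚ)) vq q hqq 2
    (fun w hw => by
      rw [← localTamagawaNumber_padic_eq_holds _ w q hw]
      exact localTamagawaNumber_padic_twistEight_q hq7 hq4)
  rw [hprod, c2, c7, cq]
  norm_num

variable {K : Type} [Field K] [NumberField K]

/-- **`∏ c_ℓ(W) = 16` FOR EVERY MODEL `W` OF `49a1^{(−2q)}`** in the coordinates of `X049BirchLemmaEvenDiscrEight`
(`W = Cd • X₀(49)^{(d_K)}`, `K` imaginary quadratic with `d_K = −8q`, `q ≡ 1 (mod 4)` prime, `(q/7) = −1`): the factor `c_W` of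
`𝔮₄₉` is the constant `16 = 2⁴` on F2 (`Tam` is a `ℚ`-isomorphism invariant, `tamagawaProduct_variableChange_eq`).
[cite: Silverman1994, IV.9.4 and Table 4.1] [cite: SilvermanAEC2009, VII.6] -/
theorem tamagawaProduct_eq_sixteen_of_smul_eq_negEight (hq : q.Prime) (hq4 : q % 4 = 1)
    (hq7 : jacobiSym q 7 = -1) (hdK : NumberField.discr K = -(8 * (q : ℤ)))
    (W : WeierstrassCurve ℚ) [W.IsElliptic] (Cd : VariableChange ℚ)
    (hW : Cd • cm7.quadraticTwist (NumberField.discr K : ℚ) = W) : W.tamagawaProduct = 16 := by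
  have hd : (((-(8 * q) : ℤ)) : ℚ) ≠ 0 := by
    have := hq.pos; exact_mod_cast (show (-(8 * (q : ℤ))) ≠ 0 by omega)
  haveI := cm7.isElliptic_quadraticTwist hd
  have hW' : W = Cd • cm7.quadraticTwist (((-(8 * q) : ℤ)) : ℚ) := by
    rw [← hW, hdK]
  have h := tamagawaProduct_variableChange_eq (cm7.quadraticTwist (((-(8 * q) : ℤ)) : ℚ)) Cd
  rw [← hW'] at h
  rw [h]
  exact tamagawaProduct_twistEight hq hq4 hq7

end AssemblyEight

/-! ## §2 `|u| = 1` for every global minimal model of `49a1^{(−2q)}` -/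

section AbsUEight

/-- **`|Cd.u| = 1` for every globally minimal `W` with `Cd • X₀(49)^{(−8q)} = W`**, `q` an odd prime `≠ 7` (both sides are
global minimal models; tree `isGloballyMinimal_unique_holds`): the factor `|u|` of `𝔮₄₉` is `1` on F2.
[cite: SilvermanAEC2009, VII.1.3(b) and VIII.8.3] -/
theorem abs_u_eq_one_of_smul_cm7_quadraticTwist_negEightMul {q : ℕ} (hq : q.Prime) (hq2 : q ≠ 2)
    (hq7 : q ≠ 7) (W : WeierstrassCurve ℚ) [W.IsGloballyMinimal] (Cd : VariableChange ℚ)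
    (hW : Cd • cm7.quadraticTwist (((-(8 * q) : ℤ)) : ℚ) = W) : |(Cd.u : ℚ)| = 1 := by
  have hd : (((-(8 * q) : ℤ)) : ℚ) ≠ 0 := by
    have := hq.pos; exact_mod_cast (show (-(8 * (q : ℤ))) ≠ 0 by omega)
  haveI := cm7.isElliptic_quadraticTwist hd
  haveI := isGloballyMinimal_cm7_quadraticTwist_negEightMul hq hq2 hq7
  haveI : (Cd • cm7.quadraticTwist (((-(8 * q) : ℤ)) : ℚ)).IsGloballyMinimal := by rw [hW]; infer_instance
  rcases (isGloballyMinimal_unique_holds (cm7.quadraticTwist (((-(8 * q) : ℤ)) : ℚ)) Cd).1 with h | h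
  · rw [h]; simp
  · rw [h]; simp

variable {K : Type} [Field K] [NumberField K]

/-- The same in the coordinates of `X049BirchLemmaEvenDiscrEight` (`Cd • X₀(49)^{(d_K)} = W`, `d_K = −8q`, `(q/7) = −1`).
[cite: SilvermanAEC2009, VII.1.3(b) and VIII.8.3] -/
theorem abs_u_eq_one_of_smul_cm7_quadraticTwist_discr_negEight {q : ℕ} (hq : q.Prime)
    (hq7 : jacobiSym q 7 = -1) (hdK : NumberField.discr K = -(8 * (q : ℤ)))
    (W : WeierstrassCurve ℚ) [W.IsGloballyMinimal] (Cd : VariableChange ℚ)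
    (hW : Cd • cm7.quadraticTwist (NumberField.discr K : ℚ) = W) : |(Cd.u : ℚ)| = 1 := by
  obtain ⟨hq2, hq7'⟩ := ne_two_and_ne_seven_of_jacobiSym hq7
  rw [hdK] at hW
  exact abs_u_eq_one_of_smul_cm7_quadraticTwist_negEightMul hq hq2 hq7' W Cd (by exact_mod_cast hW)

end AbsUEight

end Summit.BirchSwinnertonDyer.BirchSwinnertonDyer.Theorems.GoldfeldGoodTwists

end
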